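import Summits.NavierStokesRegularity.NavierStokesRegularity.Theorems.NoOverheating.Negative.TorsionWindowsExcluded
import Summits.NavierStokesRegularity.NavierStokesRegularity.Theorems.NoOverheating.Negative.SlowScrewWindowsExcluded
import Summits.NavierStokesRegularity.NavierStokesRegularity.Theorems.NoOverheating.Negative.PowerScrewWindowsExcluded

/-!
# KJ-38 — CENSUS of the excluded strata of route `AngularGalerkinLadder`'s window sequences
# (one theorem of record: KNSS 2009 m = 0 · Chae–Wolf 2017 small constant / fine ratio up to a
# power · Pineau–Vicol 2026 slow screws up to a power / fast screws)

Refuter lineage, Negative lane of crux K2 `NoOverheating` (supports, does not decide).  This file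
proves NOTHING new about fluids: it assembles the sector kills KJ-32…KJ-36 into ONE statement,
`excludedStrata_windowSequences`, so that planners, tribunal and census can cite a single decl for
"what an admissible window sequence of K2 can NOT be".  With the ABSOLUTE constant `ε₀` and, for
each Type-I constant `C₀`, thresholds `κ(C₀) > 1` (Chae–Wolf), `α₁(C₀) > 0`, `c₁(C₀) > 1`
(Pineau–Vicol (i)), `α₂(C₀) > 0`, `c₂(C₀) > 1` (Pineau–Vicol (ii)), an admissible window sequence
(`1 < cmin`, `0 < δ`, `εₙ → 0`, a window rung profile with constant `C₀` in `[cmin, cmax]` at every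
index) lies in NONE of the strata
* (S0) `C₀ ≤ ε₀` (any rotations) — `no_windowSequence_smallConstant` (KJ-33);
* (S1) every profile axisymmetric about the common axis at all negative times —
  `no_axisymmetric_windowSequence` (KJ-32; KNSS 2009 Thm 1.2/1.3);
* (S2) some power `Rₙ^q → 1` pointwise with `cmax^q < κ` (covers `Rₙ^q = 1`: finite-order torsion,
  half-turns, reflections, and `Rₙ → 1`) — `no_windowSequence_torsion_fineRatio` (KJ-33/34;
  Chae–Wolf 2017 Thm 1.3);
* (S3) some power a slow screw about any axes, `Rₙ^q = gₙ R_{θₙ} gₙ⁻¹`, `|θₙ| ≤ 2 α₁ · q log cₙ`,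
  `cmax^q < c₁` (covers slow rotoreflections at `q = 2`) — `no_windowSequence_powSlowScrew`
  (KJ-35/36; Pineau–Vicol 2026 Thm 1.7 (i));
* (S4) fast screws `Rₙ = gₙ R_{θₙ} gₙ⁻¹`, `2 α₂ log cₙ ≤ |θₙ| ≤ Θ`, `(1 + αₙ²) log cₙ ≤ ℓ < log c₂`
  — `no_windowSequence_fastScrew` (KJ-35; Pineau–Vicol 2026 Thm 1.7 (ii)).
WHAT ESCAPES (the live K2 region): `C₀ > ε₀` with DSS-isometries whose usable powers twist in
Pineau–Vicol's open middle range `α₁ < |α| < α₂`, or coarse windows (`cmax^q ≥ κ, c₁` for every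
usable `q`).  WHAT THIS IS NOT: not `¬NoOverheating` (vacuous without K1 instances), no new
Literature fact, no definition; standard axioms only.
[cite: KochNadirashviliSereginSverak2009, Theorems 1.2–1.3]
[cite: ChaeWolf2017RemovingDSS, Theorem 1.3 (arXiv:1610.09464 p. 3)]
[cite: PineauVicol2026, Theorem 1.7 (i)–(ii) (arXiv:2607.09619 p. 7)] -/

namespace Summit.NavierStokesRegularity.AngularGalerkinLadderExcludedStrataCensus

open Set Filter MeasureTheory Topology Function
open Literature.Analysis Literature.Analysis.FluidPDE
open Summit.NavierStokesRegularity.FluidComputer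
open Summit.NavierStokesRegularity.NavierStokesRegularity.Theses.AngularGalerkinLadder
open Summit.NavierStokesRegularity.AngularGalerkinLadderAxisymmetricWindowsExcluded
open Summit.NavierStokesRegularity.AngularGalerkinLadderFineRatioWindowsExcluded
open Summit.NavierStokesRegularity.AngularGalerkinLadderTorsionWindowsExcluded
open Summit.NavierStokesRegularity.AngularGalerkinLadderSlowScrewWindowsExcluded
open Summit.NavierStokesRegularity.AngularGalerkinLadderPowerScrewWindowsExcluded

/-- **Census theorem: the excluded strata of K2's window sequences.**  There is an absolute
`ε₀ > 0`, and for every `C₀` thresholds `κ > 1`, `α₁ > 0`, `c₁ > 1`, `α₂ > 0`, `c₂ > 1`, such that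
every admissible window sequence with constant `C₀` avoids the union of the strata (S0)–(S4) of
the module docstring.  Assembly of `no_windowSequence_smallConstant`,
`no_axisymmetric_windowSequence`, `no_windowSequence_torsion_fineRatio`,
`no_windowSequence_powSlowScrew`, `no_windowSequence_fastScrew`.
[cite: KochNadirashviliSereginSverak2009, Theorems 1.2–1.3]
[cite: ChaeWolf2017RemovingDSS, Theorem 1.3]
[cite: PineauVicol2026, Theorem 1.7 (i)–(ii)] -/
theorem excludedStrata_windowSequences :
    ∃ ε₀ : ℝ, 0 < ε₀ ∧ ∀ C₀ : ℝ, ∃ κ α₁ c₁ α₂ c₂ : ℝ,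
      1 < κ ∧ 0 < α₁ ∧ 1 < c₁ ∧ 0 < α₂ ∧ 1 < c₂ ∧
      ∀ {cmin cmax δ : ℝ} {L : ℕ → ℕ} {ε c : ℕ → ℝ}
        {R : ℕ → (EuclideanSpace ℝ (Fin 3) ≃ₗᵢ[ℝ] EuclideanSpace ℝ (Fin 3))}
        {u : ℕ → ℝ → EuclideanSpace ℝ (Fin 3) → EuclideanSpace ℝ (Fin 3)}
        {p : ℕ → ℝ → EuclideanSpace ℝ (Fin 3) → ℝ}
        {d : ℕ → ℝ → EuclideanSpace ℝ (Fin 3) → EuclideanSpace ℝ (Fin 3)},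
        1 < cmin → 0 < δ → Tendsto ε atTop (𝓝 0) →
        (∀ n, AngularLadder.IsWindowProfile (L n) C₀ cmin cmax δ (ε n) (c n) (R n) (u n) (p n)
          (d n)) →
        ¬ (C₀ ≤ ε₀ ∨
           (∀ n, ∀ t < 0, IsAxisymmetric (u n t)) ∨
           (∃ q : ℕ, 0 < q ∧ cmax ^ q < κ ∧
              ∀ x, Tendsto (fun n => ((R n) ^ q) x) atTop (𝓝 x)) ∨
           (∃ (q : ℕ) (g : ℕ → (EuclideanSpace ℝ (Fin 3) ≃ₗᵢ[ℝ] EuclideanSpace ℝ (Fin 3)))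
              (θ : ℕ → ℝ),
              0 < q ∧ cmax ^ q < c₁ ∧ (∀ n x, ((R n) ^ q) x = g n (rotZ (θ n) ((g n).symm x))) ∧
              ∀ n, |θ n| ≤ 2 * α₁ * (q * Real.log (c n))) ∨
           (∃ (Θ ℓ : ℝ) (g : ℕ → (EuclideanSpace ℝ (Fin 3) ≃ₗᵢ[ℝ] EuclideanSpace ℝ (Fin 3)))
              (θ : ℕ → ℝ),
              ℓ < Real.log c₂ ∧ (∀ n x, R n x = g n (rotZ (θ n) ((g n).symm x))) ∧
              (∀ n, |θ n| ≤ Θ) ∧ (∀ n, 2 * α₂ * Real.log (c n) ≤ |θ n|) ∧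
              ∀ n, (1 + (θ n / (2 * Real.log (c n))) ^ 2) * Real.log (c n) ≤ ℓ)) := by
  obtain ⟨ε₀, hε₀, H0⟩ := no_windowSequence_smallConstant
  refine ⟨ε₀, hε₀, fun C₀ => ?_⟩
  obtain ⟨κ, hκ, H2⟩ := no_windowSequence_torsion_fineRatio C₀
  obtain ⟨α₁, hα₁, c₁, hc₁, H3⟩ := no_windowSequence_powSlowScrew C₀
  obtain ⟨α₂, hα₂, c₂, hc₂, H4⟩ := no_windowSequence_fastScrew C₀
  refine ⟨κ, α₁, c₁, α₂, c₂, hκ, hα₁, hc₁, hα₂, hc₂,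
    fun {cmin cmax δ L ε c R u p d} hcmin hδ hε hW => ?_⟩
  rintro (h0 | h1 | ⟨q, hq, hcq, hR⟩ | ⟨q, g, θ, hq, hcq, hconj, hθ⟩ |
    ⟨Θ, ℓ, g, θ, hℓ, hconj, hΘ, hlow, hquad⟩)
  · exact H0 h0 hcmin hδ hε hW
  · exact no_axisymmetric_windowSequence ⟨C₀, cmin, cmax, δ, L, ε, c, R, u, p, d, hcmin, hδ, hε,
      hW, h1⟩
  · exact H2 hq hcq hcmin hδ hε hW hR
  · exact H3 hq hcq hcmin hδ hε hW hconj hθ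
  · exact H4 hℓ hcmin hδ hε hW hconj hΘ hlow hquad

/-- **The finite-order and unrotated strata are inside (S2)** (bookkeeping for the census): if
`Rₙ^q = 1` for all `n` then `Rₙ^q → 1` pointwise, so `no_windowSequence_finiteOrder_fineRatio` and
(at `q = 1`, `Rₙ = 1`) the unrotated fine-ratio stratum are instances of (S2).
[cite: ChaeWolf2017RemovingDSS, Theorem 1.3 and Remark 1.4] -/
theorem tendsto_pow_apply_of_pow_eq_one {q : ℕ}
    {R : ℕ → (EuclideanSpace ℝ (Fin 3) ≃ₗᵢ[ℝ] EuclideanSpace ℝ (Fin 3))}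
    (h : ∀ n, (R n) ^ q = 1) (x : EuclideanSpace ℝ (Fin 3)) :
    Tendsto (fun n => ((R n) ^ q) x) atTop (𝓝 x) := by
  have : (fun n => ((R n) ^ q) x) = fun _ => x := funext fun n => by rw [h n]; rfl
  rw [this]
  exact tendsto_const_nhds

end Summit.NavierStokesRegularity.AngularGalerkinLadderExcludedStrataCensus
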